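import Mathlib
import HarnessLib
import Summits.Ventures.LatticeQCDFlow.Scaling.WilsonActionNontrivial
import Summits.Ventures.LatticeQCDFlow.Scaling.AcceptanceEssEightNinthsStrict

/-!
# LatticeQCDFlow / Scaling — the STRICT two-sided acceptance sandwich of the untrained samplers:
# `(8/9)·Z(β)²/Z(2β) < acc < Z(β/2)²/Z(β)`

HONEST FRAMING: exact (Metropolis-corrected) sampling algorithms for lattice gauge theory;
figures of merit are autocorrelation/cost numbers at stated couplings and volumes; no
continuum-physics claim.

Venture `LatticeQCDFlow` (cell pub-lqcd), topic `Scaling`; FANOUT row 3 (`s0-u1-a`, S0-B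
implementation A, GEN-14).  ASSEMBLY (no new mathematics): the strict floor of row 3's
`Scaling/AcceptanceEssEightNinthsStrict` and the strict ceilings of row 3's
`Scaling/IdentityFlowStrictLaws` / `Scaling/WilsonActionNontrivial` (all imported) put side by side,
so that the zero-training row of the boards can be quoted as ONE two-sided strict statement per
sampler.  NO definition is introduced.

* **`wilsonIdentityFlow_strictSandwich`** — any compact `G`, continuous `ρ` with a non-maximal trace
  value, torus `(ℤ/L)^d` with `L ≥ 2` and directions `i < j`, `β ≠ 0`, reference law `Haar^{⊗E}`:
  `(8/9)·Z(β)²/Z(2β) < acc < Z(β/2)²/Z(β)` with `Z = (partitionFunction ρ ·).toReal`;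
* **`u1IdentityFlow_torus_strictSandwich`**, **`su2IdentityFlow_torus_strictSandwich`** — the U(1)
  and SU(2) instances, unconditional;
* **`u1IdentityFlow_strictSandwich`** — `V = card ι ≥ 1` independent U(1) plaquettes, `β ≠ 0`:
  `(8/9)·(I₀(β)²/I₀(2β))^V < acc_V < (I₀(β/2)²/I₀(β))^V` (GEN-12's sandwich, now strict on both
  sides);
* (the box-coordinate torus of row 5 has the same two strict sides as separate theorems:
  `u1TorusIdentityFlow_meanAccept_gt` in `Scaling/U1WilsonIdentityFlowStrictFloor` (every `β`) and
  `u1TorusIdentityFlow_meanAccept_lt` in `Scaling/U1TorusIdentityFlowStrictCeiling` (`β > 0`, a side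
  `≥ 2`); not re-bundled here.)

Reading (value-free): for the untrained exact sampler the equilibrium acceptance lies STRICTLY
between `8/9` of its effective sample size and its Bhattacharyya ceiling — for U(1) and SU(2) on
every periodic lattice with `L ≥ 2`, `d ≥ 2`, `β ≠ 0`, and for independent U(1) plaquettes in
Bessel closed form.  NOT CLAIMED: any VALUE of ours at the cell's `(β, L)`; the size of either gap;
nothing re-scored.
-/

noncomputable section

namespace Summit.Ventures.LatticeQCDFlow.Theory2

open MeasureTheory Real Set Finset
open Literature.Analysis.FunctionSpaces (besselI)
open Literature.MathematicalPhysics.QuantumFieldTheory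
open Literature.MathematicalPhysics.QuantumLattice (fundamentalRep continuous_fundamentalRep u1Rep
  continuous_u1Rep)
open Summit.Ventures.LatticeQCDFlow.Scoring (onePlaquetteZ)

/-! ## The untrained Wilson sampler of a compact gauge group (`μ = Haar^{⊗E}`) -/

section Wilson

variable {d L N : ℕ} [NeZero L] [Fact (1 < L)] {G : Type*} [Group G] [TopologicalSpace G]
  [IsTopologicalGroup G] [CompactSpace G] [MeasurableSpace G] [BorelSpace G]
  (ρ : G →* Matrix (Fin N) (Fin N) ℂ)

/-- **THE STRICT TWO-SIDED SANDWICH OF THE UNTRAINED WILSON SAMPLER**: for every compact `G`,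
continuous `ρ` with a non-maximal trace value, torus `(ℤ/L)^d` with `L ≥ 2` and two directions
`i < j`, and every `β ≠ 0`: `(8/9)·Z(β)²/Z(2β) < acc < Z(β/2)²/Z(β)`,
`Z = (partitionFunction ρ ·).toReal`. [ours] -/
theorem wilsonIdentityFlow_strictSandwich (hρ : Continuous ρ) {β : ℝ} (hβ : β ≠ 0) {i j : Fin d}
    (hij : i < j) (hg : ∃ g : G, (ρ g).trace.re ≠ N) :
    8 / 9 * ((partitionFunction (d := d) (L := L) ρ β).toReal ^ 2
        / (partitionFunction (d := d) (L := L) ρ (2 * β)).toReal)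
      < ∫ U, ∫ U', min (Real.exp (-β * wilsonAction ρ U) / ∫ V, Real.exp (-β * wilsonAction ρ V)
            ∂(Measure.pi fun _ : Edge d L => haarProbability G))
        (Real.exp (-β * wilsonAction ρ U') / ∫ V, Real.exp (-β * wilsonAction ρ V)
            ∂(Measure.pi fun _ : Edge d L => haarProbability G))
        ∂(Measure.pi fun _ : Edge d L => haarProbability G)
        ∂(Measure.pi fun _ : Edge d L => haarProbability G) ∧
    ∫ U, ∫ U', min (Real.exp (-β * wilsonAction ρ U) / ∫ V, Real.exp (-β * wilsonAction ρ V)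
            ∂(Measure.pi fun _ : Edge d L => haarProbability G))
        (Real.exp (-β * wilsonAction ρ U') / ∫ V, Real.exp (-β * wilsonAction ρ V)
            ∂(Measure.pi fun _ : Edge d L => haarProbability G))
        ∂(Measure.pi fun _ : Edge d L => haarProbability G)
        ∂(Measure.pi fun _ : Edge d L => haarProbability G)
      < (partitionFunction (d := d) (L := L) ρ (β / 2)).toReal ^ 2
          / (partitionFunction (d := d) (L := L) ρ β).toReal :=
  ⟨wilsonIdentityFlow_meanAccept_gt_partitionFunction ρ hρ β,
    wilsonIdentityFlow_meanAccept_lt_of_trace ρ hρ hβ hij hg⟩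

end Wilson

/-! ## U(1) and SU(2) on the torus, unconditionally -/

section Instances

variable {d L : ℕ} [NeZero L] [Fact (1 < L)]

/-- **U(1)**: `(8/9)·Z(β)²/Z(2β) < acc < Z(β/2)²/Z(β)` for the untrained sampler of compact U(1)
lattice gauge theory on `(ℤ/L)^d`, `L ≥ 2`, directions `i < j`, `β ≠ 0`. [ours] -/
theorem u1IdentityFlow_torus_strictSandwich {β : ℝ} (hβ : β ≠ 0) {i j : Fin d} (hij : i < j) :
    8 / 9 * ((partitionFunction (d := d) (L := L) u1Rep β).toReal ^ 2
        / (partitionFunction (d := d) (L := L) u1Rep (2 * β)).toReal)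
      < ∫ U, ∫ U', min (Real.exp (-β * wilsonAction u1Rep U) / ∫ V, Real.exp (-β * wilsonAction u1Rep V)
            ∂(Measure.pi fun _ : Edge d L => haarProbability Circle))
        (Real.exp (-β * wilsonAction u1Rep U') / ∫ V, Real.exp (-β * wilsonAction u1Rep V)
            ∂(Measure.pi fun _ : Edge d L => haarProbability Circle))
        ∂(Measure.pi fun _ : Edge d L => haarProbability Circle)
        ∂(Measure.pi fun _ : Edge d L => haarProbability Circle) ∧
    ∫ U, ∫ U', min (Real.exp (-β * wilsonAction u1Rep U) / ∫ V, Real.exp (-β * wilsonAction u1Rep V)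
            ∂(Measure.pi fun _ : Edge d L => haarProbability Circle))
        (Real.exp (-β * wilsonAction u1Rep U') / ∫ V, Real.exp (-β * wilsonAction u1Rep V)
            ∂(Measure.pi fun _ : Edge d L => haarProbability Circle))
        ∂(Measure.pi fun _ : Edge d L => haarProbability Circle)
        ∂(Measure.pi fun _ : Edge d L => haarProbability Circle)
      < (partitionFunction (d := d) (L := L) u1Rep (β / 2)).toReal ^ 2
          / (partitionFunction (d := d) (L := L) u1Rep β).toReal :=
  wilsonIdentityFlow_strictSandwich u1Rep continuous_u1Rep hβ hij Lattice.TwoDim.exists_u1_trace_re_ne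

/-- **SU(2)**: `(8/9)·Z(β)²/Z(2β) < acc < Z(β/2)²/Z(β)` for the untrained sampler of SU(2) lattice
gauge theory on `(ℤ/L)^d`, `L ≥ 2`, directions `i < j`, `β ≠ 0`. [ours] -/
theorem su2IdentityFlow_torus_strictSandwich {β : ℝ} (hβ : β ≠ 0) {i j : Fin d} (hij : i < j) :
    8 / 9 * ((partitionFunction (d := d) (L := L) (fundamentalRep (Fin 2)) β).toReal ^ 2
        / (partitionFunction (d := d) (L := L) (fundamentalRep (Fin 2)) (2 * β)).toReal)
      < ∫ U, ∫ U', min (Real.exp (-β * wilsonAction (fundamentalRep (Fin 2)) U)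
          / ∫ V, Real.exp (-β * wilsonAction (fundamentalRep (Fin 2)) V)
            ∂(Measure.pi fun _ : Edge d L => haarProbability (Matrix.specialUnitaryGroup (Fin 2) ℂ)))
        (Real.exp (-β * wilsonAction (fundamentalRep (Fin 2)) U')
          / ∫ V, Real.exp (-β * wilsonAction (fundamentalRep (Fin 2)) V)
            ∂(Measure.pi fun _ : Edge d L => haarProbability (Matrix.specialUnitaryGroup (Fin 2) ℂ)))
        ∂(Measure.pi fun _ : Edge d L => haarProbability (Matrix.specialUnitaryGroup (Fin 2) ℂ))
        ∂(Measure.pi fun _ : Edge d L => haarProbability (Matrix.specialUnitaryGroup (Fin 2) ℂ)) ∧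
    ∫ U, ∫ U', min (Real.exp (-β * wilsonAction (fundamentalRep (Fin 2)) U)
          / ∫ V, Real.exp (-β * wilsonAction (fundamentalRep (Fin 2)) V)
            ∂(Measure.pi fun _ : Edge d L => haarProbability (Matrix.specialUnitaryGroup (Fin 2) ℂ)))
        (Real.exp (-β * wilsonAction (fundamentalRep (Fin 2)) U')
          / ∫ V, Real.exp (-β * wilsonAction (fundamentalRep (Fin 2)) V)
            ∂(Measure.pi fun _ : Edge d L => haarProbability (Matrix.specialUnitaryGroup (Fin 2) ℂ)))
        ∂(Measure.pi fun _ : Edge d L => haarProbability (Matrix.specialUnitaryGroup (Fin 2) ℂ))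
        ∂(Measure.pi fun _ : Edge d L => haarProbability (Matrix.specialUnitaryGroup (Fin 2) ℂ))
      < (partitionFunction (d := d) (L := L) (fundamentalRep (Fin 2)) (β / 2)).toReal ^ 2
          / (partitionFunction (d := d) (L := L) (fundamentalRep (Fin 2)) β).toReal :=
  wilsonIdentityFlow_strictSandwich (fundamentalRep (Fin 2)) (continuous_fundamentalRep _) hβ hij
    su2_exists_trace_ne

end Instances

/-! ## `V` independent U(1) plaquettes -/

section U1

variable {ι : Type*} [Fintype ι]

/-- **THE STRICT SANDWICH FOR `V ≥ 1` UNTRAINED U(1) PLAQUETTES**, `β ≠ 0`: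
`(8/9)·(I₀(β)²/I₀(2β))^V < acc_V < (I₀(β/2)²/I₀(β))^V`. [ours] -/
theorem u1IdentityFlow_strictSandwich [Nonempty ι] {β : ℝ} (hβ : β ≠ 0) :
    8 / 9 * (besselI 0 β ^ 2 / besselI 0 (2 * β)) ^ Fintype.card ι
      < ∫ x, ∫ x', min ((∏ i : ι, Real.exp (β * Real.cos (x i)) / onePlaquetteZ β)
            * ∏ _i : ι, (1 / (2 * π) : ℝ))
          ((∏ i : ι, Real.exp (β * Real.cos (x' i)) / onePlaquetteZ β) * ∏ _i : ι, (1 / (2 * π) : ℝ))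
          ∂(Measure.pi fun _ : ι => volume.restrict (Ioc (0 : ℝ) (2 * π)))
          ∂(Measure.pi fun _ : ι => volume.restrict (Ioc (0 : ℝ) (2 * π))) ∧
    ∫ x, ∫ x', min ((∏ i : ι, Real.exp (β * Real.cos (x i)) / onePlaquetteZ β)
          * ∏ _i : ι, (1 / (2 * π) : ℝ))
        ((∏ i : ι, Real.exp (β * Real.cos (x' i)) / onePlaquetteZ β) * ∏ _i : ι, (1 / (2 * π) : ℝ))
        ∂(Measure.pi fun _ : ι => volume.restrict (Ioc (0 : ℝ) (2 * π)))
        ∂(Measure.pi fun _ : ι => volume.restrict (Ioc (0 : ℝ) (2 * π)))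
      < (besselI 0 (β / 2) ^ 2 / besselI 0 β) ^ Fintype.card ι :=
  ⟨u1IdentityFlow_meanAccept_gt β, u1IdentityFlow_meanAccept_lt_pow hβ⟩

end U1

end Summit.Ventures.LatticeQCDFlow.Theory2
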